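import Mathlib
import HarnessLib
import Summits.HubbardSuperconductivity.HubbardSuperconductivity.Theorems.KLProgrammeKLRegimeWickScaleFlowC1

/-!
# Route `KLProgramme` — crux K3, ENGINE child (gen 6 `KLRegimeEngineV16` stmt-…-20236; gen 7-flow `KLRegimeEngineV17F` at K := K_n),
# stub `stub_engine_step_values`, conjunct (E2) at `1 ≤ n`: flow data of the Wick pair kernel along ANY twice-differentiable covariance curve —
# `klws_vertexFn_flowData_of_covCurve`, `klws_pairKernel_flowData_of_covCurve`

Cell gate-hubbard-kl, seat hubbard-kl-k3c1-p1 (g7), technique «composed-map remainder propagation».  `klws_pairKernelR_flowData`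
(`…WickScaleFlowSlice`, p505675) discharges the inputs `hΓ` (entrywise derivative) and `hΓ'c` (continuous derivative) of the weighted Duhamel
comparison for the BARE covariance family `Λ ↦ hubbardCovAboveCT … K Λ`.  Under the organisation of record after the K3-FLOW ruling (KL STATUS
2026-08-27T10:17Z: scheme F, frames `K_n`) and the Σ-dressing cure (R1′) (p1 g10 E2-SIGMA-DRESSING; `effAction_normalCovariance_add_diagQuadratic`
p521577, dressed lines p522645) the slice is flown with a DRESSED covariance family (`normalCovariance (s_Λ/(1 + s_Λκ_{n−1}))`, p1 g10 KL STATUS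
10:18:58Z).  This file states the flow data ONCE for an arbitrary covariance curve, so that any such family plugs in with its first two entrywise
derivatives only:

* **`klws_vertexFn_flowData_of_covCurve`** — for a curve `C : ℝ → Matrix` with entrywise derivatives `C′` and `C″` on a set `S`, a total
  covariance `C∞`, an even input `V` without constant part and `Z(C_r, V) ≠ 0` on `S`: every positive-degree vertex function of the Wick carrier
  `𝒲_r := e^{Δ_{C∞ − C_r}}·effAction (C_r) V` has derivative `−½·𝒱_m(e^{Δ_{C∞−C_r}}(δ𝒱_r/δψ, Ċ_r δ𝒱_r/δψ))` on `S`, continuous on `S`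
  (generic layer: `klws_hasDerivAt_kernel_wickCarrier` p504230, `klws_continuousAt_kernel_wickSource` p504925);
* **`klws_pairKernel_flowData_of_covCurve`** — the same packaged as the pair-kernel matrix on `TorusSite 2 L × MatsubaraIdx M` at total
  momentum `Q` (p1's label tuple), i.e. literally the `hΓ`/`hΓ'c` inputs of `kltc_riccati_duhamel_weighted` (p500198) /
  `kltc_wickStep_of_flow(_conjugated)` (p501252 / p522267) on `S = [0,1]`.

Exact calculus; nothing about the model's sizes is asserted.  0 kit.
-/

noncomputable section

namespace Summit.HubbardSuperconductivity.HubbardSuperconductivity.Theorems.KLRegimeWick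

set_option linter.dupNamespace false -- summit = problem name (single-conjunct summit), D-0017

open Set Finset Matrix Literature.MathematicalPhysics.QuantumLattice GrassmannAlgebra
open Literature.Probability.LatticeModels
open scoped Topology

section Model

variable (L M : ℕ) [NeZero L] (β : ℝ)

/-- **Flow data of the vertex functions of the Wick carrier along a twice-differentiable covariance curve.**  `C : ℝ → Matrix` with
entrywise `HasDerivAt (C · X Y) (C′ r X Y) r` and `HasDerivAt (C′ · X Y) (C″ r X Y) r` for `r ∈ S`; total covariance `C∞`; input `V` even with
`constPart V = 0`; `effPartitionFn ℂ (C r) V ≠ 0` on `S`.  THEN for `0 < m` and every label tuple `X`: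
`r ↦ 𝒱_m(e^{Δ_{C∞−C_r}} effAction (C r) V)(X)` has derivative `−½·𝒱_m(e^{Δ_{C∞−C_r}}(δ𝒱_r/δψ, C′_r δ𝒱_r/δψ))(X)` at every `r ∈ S`, and that
derivative is continuous on `S`. -/
theorem klws_vertexFn_flowData_of_covCurve (C C' C'' : ℝ → Matrix (HubbardFieldIdx L M) (HubbardFieldIdx L M) ℂ)
    (Cinf : Matrix (HubbardFieldIdx L M) (HubbardFieldIdx L M) ℂ) (S : Set ℝ)
    (hC : ∀ r ∈ S, ∀ X Y, HasDerivAt (fun s => C s X Y) (C' r X Y) r)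
    (hC' : ∀ r ∈ S, ∀ X Y, HasDerivAt (fun s => C' s X Y) (C'' r X Y) r)
    (V : HubbardGrassmann L M) (hV0 : constPart ℂ V = 0) (hVe : V ∈ evenOdd ℂ 0) (hZ : ∀ r ∈ S, effPartitionFn ℂ (C r) V ≠ 0)
    {m : ℕ} (hm : 0 < m) (X : Fin m → HubbardFieldIdx L M) :
    (∀ r ∈ S, HasDerivAt (fun s => vertexFn L M β (gaussConv ℂ (Cinf - C s) (effAction ℂ (C s) V)) m X)
      (-((2 : ℂ)⁻¹ * vertexFn L M β (gaussConv ℂ (Cinf - C r)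
        (grassmannDerivPairing ℂ (C' r) (effAction ℂ (C r) V) (effAction ℂ (C r) V))) m X)) r) ∧
    ContinuousOn (fun r => -((2 : ℂ)⁻¹ * vertexFn L M β (gaussConv ℂ (Cinf - C r)
        (grassmannDerivPairing ℂ (C' r) (effAction ℂ (C r) V) (effAction ℂ (C r) V))) m X)) S := by
  letI : LinearOrder (HubbardFieldIdx L M) := LinearOrder.lift' (Fintype.equivFin _) (Fintype.equivFin _).injective
  refine ⟨fun r hr => ?_, fun r hr => ?_⟩
  · have h := (klws_hasDerivAt_kernel_wickCarrier (𝕂 := ℝ) Cinf (hC r hr) hV0 hVe (hZ r hr) hm X).const_mul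
      ((((m.factorial : ℝ) * (β * (L : ℝ) ^ 2) ^ (m - 1) : ℝ) : ℂ))
    simp only [vertexFn_def]
    refine h.congr_deriv ?_
    ring
  · have h := (klws_continuousAt_kernel_wickSource (𝕂 := ℝ) Cinf (hC r hr) hV0 hVe (hZ r hr) (hC' r hr) m X).const_mul
      ((((m.factorial : ℝ) * (β * (L : ℝ) ^ 2) ^ (m - 1) : ℝ) : ℂ))
    simp only [vertexFn_def]
    exact ((h.const_mul (2 : ℂ)⁻¹).neg).continuousWithinAt

/-- **Flow data of the pair kernel along a twice-differentiable covariance curve** (the `hΓ`, `hΓ'c` inputs of the weighted / conjugated Duhamel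
comparison on `[0,1]`): with `Γ t := 𝒱₄(𝒲_t)(pair labels at total momentum Q)` and `Γ̇ t := −½·𝒱₄(e^{Δ_{C∞−C_t}}(δ𝒱_t/δψ, C′_t δ𝒱_t/δψ))(…)`
(given by equations — pass `rfl, rfl`): entrywise `HasDerivAt` on `[0,1]` and entrywise continuity of `Γ̇` on `[0,1]`. -/
theorem klws_pairKernel_flowData_of_covCurve [NeZero M] (C C' C'' : ℝ → Matrix (HubbardFieldIdx L M) (HubbardFieldIdx L M) ℂ)
    (Cinf : Matrix (HubbardFieldIdx L M) (HubbardFieldIdx L M) ℂ)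
    (hC : ∀ r ∈ Icc (0 : ℝ) 1, ∀ X Y, HasDerivAt (fun s => C s X Y) (C' r X Y) r)
    (hC' : ∀ r ∈ Icc (0 : ℝ) 1, ∀ X Y, HasDerivAt (fun s => C' s X Y) (C'' r X Y) r)
    (V : HubbardGrassmann L M) (hV0 : constPart ℂ V = 0) (hVe : V ∈ evenOdd ℂ 0)
    (hZ : ∀ r ∈ Icc (0 : ℝ) 1, effPartitionFn ℂ (C r) V ≠ 0) (Q : TorusSite 2 L)
    (Γ Γ' : ℝ → Matrix (TorusSite 2 L × MatsubaraIdx M) (TorusSite 2 L × MatsubaraIdx M) ℂ)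
    (hΓdef : Γ = fun t => Matrix.of fun x y => vertexFn L M β (gaussConv ℂ (Cinf - C t) (effAction ℂ (C t) V)) 4
      ![(((y.2, y.1), 0), 0), (((y.2.rev, Q - y.1), 1), 0), (((x.2.rev, Q - x.1), 1), 1), (((x.2, x.1), 0), 1)])
    (hΓ'def : Γ' = fun t => Matrix.of fun x y => -((2 : ℂ)⁻¹ * vertexFn L M β (gaussConv ℂ (Cinf - C t)
        (grassmannDerivPairing ℂ (C' t) (effAction ℂ (C t) V) (effAction ℂ (C t) V))) 4
      ![(((y.2, y.1), 0), 0), (((y.2.rev, Q - y.1), 1), 0), (((x.2.rev, Q - x.1), 1), 1), (((x.2, x.1), 0), 1)])) :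
    (∀ t ∈ Icc (0 : ℝ) 1, ∀ x y, HasDerivAt (fun s => Γ s x y) (Γ' t x y) t) ∧
      ∀ x y, ContinuousOn (fun t => Γ' t x y) (Icc 0 1) := by
  subst hΓdef hΓ'def
  refine ⟨fun t ht x y => ?_, fun x y => ?_⟩
  · have h := (klws_vertexFn_flowData_of_covCurve L M β C C' C'' Cinf (Icc 0 1) hC hC' V hV0 hVe hZ (by norm_num : 0 < 4)
      ![(((y.2, y.1), 0), 0), (((y.2.rev, Q - y.1), 1), 0), (((x.2.rev, Q - x.1), 1), 1), (((x.2, x.1), 0), 1)]).1 t ht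
    simpa only [Matrix.of_apply] using h
  · have h := (klws_vertexFn_flowData_of_covCurve L M β C C' C'' Cinf (Icc 0 1) hC hC' V hV0 hVe hZ (by norm_num : 0 < 4)
      ![(((y.2, y.1), 0), 0), (((y.2.rev, Q - y.1), 1), 0), (((x.2.rev, Q - x.1), 1), 1), (((x.2, x.1), 0), 1)]).2
    simpa only [Matrix.of_apply] using h

end Model

end Summit.HubbardSuperconductivity.HubbardSuperconductivity.Theorems.KLRegimeWick

end
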